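import Summits.ResolutionOfSingularities.ResolutionOfSingularities.Theorems.PurelyInseparableDim4JointTwoHostsCharts
import Literature.AlgebraicGeometry.Resolution.WeightedBlowupNoIncrease
import HarnessLib

/-!
# Purely inseparable four-folds: computations for the HEREDITARY-WAITING certificate
# `F = x₁ x₂^{p−1} x₃ x₄ + x₁^{2p−2} x₂ + x₂^{p+1}` (brick S3 (c) «joint point∘coordinate chains», part 67a; cell `res-dim4-pi`)

[OURS · counted 0] (D-0157 DOOR 2; host item stmt-ResolutionOfSingularities-16155, helper). Nothing here proves resolution of
singularities in dimension ≥ 4 / characteristic `p`. Model-level computations (no scheme) for the first certificate of the v3-H chain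
(parts 58–66): the root host is `V(z, x₁, x₂)`; on the `x₁`-chart the order-`p` locus inside the exceptional divisor is the CROSS of the
two curves `{y₁ = y₂ = x₃ = 0}` (the child) and `{y₁ = y₂ = x₄ = 0}` (its HEREDITARY waiting sibling), meeting at the origin.

* §1 four-exponent forms of `F`, its `x₁`- and `x₂`-chart transforms `F₁`, `F₂`, the child's charts `G₀, G₁, G₂` of `F₁` along
  `V(z, y₁, y₂, x₃)`, the kid's charts `H₀, H₁, H₃` of `G₂` along `V(z, w₁, w₂, x₄)` (chart exponent law, `degIn` on triples);
* §2 supports, cleanness, `F ≠ 0`, permissibility of the five centres;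
* §3 `roots_hcert` — order `p` forces `b₁ = b₂ = 0` (FIRST derivatives: the term `x₂^{p+1}` is there to make this so).

AI-produced formalisation, weaker than expert review. bears_on: LADDER-RESOLUTION:D157-DOOR2 (res-dim4-pi · S3 (c) v3-H certificate · computations).
-/

set_option linter.dupNamespace false -- D-0017: single-problem summit path `Summit.<S>.<S>.…` by design

noncomputable section

open MvPolynomial Finset

namespace Summit.ResolutionOfSingularities.ResolutionOfSingularities.Theorems.PIDim4

open Literature.AlgebraicGeometry.Resolution
open Literature.AlgebraicGeometry.Resolution.Hauser2010

namespace Equimultiple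

section HCertComputations

variable {K : Type} [Field K] {p : ℕ} [hp : Fact p.Prime] [CharP K p]

/-! ## §1 Forms and chart transforms -/

omit hp [CharP K p] in
/-- `degIn` on a triple `{i, j, k}`. [cite: HauserPerlega2019PRIMS, §2 (ord_P of a monomial)] -/
theorem degIn_triple {i j k : Fin 4} (hij : i ≠ j) (hik : i ≠ k) (hjk : j ≠ k) (d : Fin 4 →₀ ℕ) :
    CentreBlowup.degIn ({i, j, k} : Finset (Fin 4)) d = d i + d j + d k := by
  rw [CentreBlowup.degIn_insert (by simp [hij, hik]), CentreBlowup.degIn_pair hjk, add_assoc]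

omit hp [CharP K p] in
/-- `F` in four-exponent form. [folklore] -/
theorem hcert_eq :
    (X 0 * X 1 ^ (p - 1) * X 2 * X 3 + X 0 ^ (2 * p - 2) * X 1 + X 1 ^ (p + 1) : MvPolynomial (Fin 4) K) =
      C 1 * (X 0 ^ 1 * X 1 ^ (p - 1) * X 2 ^ 1 * X 3 ^ 1) + C 1 * (X 0 ^ (2 * p - 2) * X 1 ^ 1 * X 2 ^ 0 * X 3 ^ 0) +
        C 1 * (X 0 ^ 0 * X 1 ^ (p + 1) * X 2 ^ 0 * X 3 ^ 0) := by
  simp only [pow_zero, pow_one, mul_one, C_1, one_mul]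

omit hp [CharP K p] in
/-- Chart `x₁` of the blow-up of `V(z, x₁, x₂, x₃)` (a triple centre). [cite: HauserPerlega2019PRIMS, §2 (the x₁-chart)] -/
theorem chartExponent_U0_four (a b c d : ℕ) :
    CentreBlowup.chartExponent p ({0, 1, 2} : Finset (Fin 4)) 0
        (Finsupp.single 0 a + Finsupp.single 1 b + Finsupp.single 2 c + Finsupp.single 3 d) =
      Finsupp.single 0 (a + b + c - p) + Finsupp.single 1 b + Finsupp.single 2 c + Finsupp.single 3 d := by
  ext i; fin_cases i <;>
    simp [CentreBlowup.chartExponent, Finsupp.update_apply, degIn_triple (show (0 : Fin 4) ≠ 1 by decide)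
      (show (0 : Fin 4) ≠ 2 by decide) (show (1 : Fin 4) ≠ 2 by decide)]

omit hp [CharP K p] in
/-- Chart `x₂` of the blow-up of `V(z, x₁, x₂, x₃)`. [cite: HauserPerlega2019PRIMS, §2 (the x₁-chart)] -/
theorem chartExponent_U1_four (a b c d : ℕ) :
    CentreBlowup.chartExponent p ({0, 1, 2} : Finset (Fin 4)) 1
        (Finsupp.single 0 a + Finsupp.single 1 b + Finsupp.single 2 c + Finsupp.single 3 d) =
      Finsupp.single 0 a + Finsupp.single 1 (a + b + c - p) + Finsupp.single 2 c + Finsupp.single 3 d := by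
  ext i; fin_cases i <;>
    simp [CentreBlowup.chartExponent, Finsupp.update_apply, degIn_triple (show (0 : Fin 4) ≠ 1 by decide)
      (show (0 : Fin 4) ≠ 2 by decide) (show (1 : Fin 4) ≠ 2 by decide)]

omit hp [CharP K p] in
/-- Chart `x₃` of the blow-up of `V(z, x₁, x₂, x₃)`. [cite: HauserPerlega2019PRIMS, §2 (the x₁-chart)] -/
theorem chartExponent_U2_four (a b c d : ℕ) :
    CentreBlowup.chartExponent p ({0, 1, 2} : Finset (Fin 4)) 2
        (Finsupp.single 0 a + Finsupp.single 1 b + Finsupp.single 2 c + Finsupp.single 3 d) =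
      Finsupp.single 0 a + Finsupp.single 1 b + Finsupp.single 2 (a + b + c - p) + Finsupp.single 3 d := by
  ext i; fin_cases i <;>
    simp [CentreBlowup.chartExponent, Finsupp.update_apply, degIn_triple (show (0 : Fin 4) ≠ 1 by decide)
      (show (0 : Fin 4) ≠ 2 by decide) (show (1 : Fin 4) ≠ 2 by decide)]

omit hp [CharP K p] in
/-- Chart `x₁` of the blow-up of `V(z, x₁, x₂, x₄)`. [cite: HauserPerlega2019PRIMS, §2 (the x₁-chart)] -/
theorem chartExponent_V0_four (a b c d : ℕ) :
    CentreBlowup.chartExponent p ({0, 1, 3} : Finset (Fin 4)) 0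
        (Finsupp.single 0 a + Finsupp.single 1 b + Finsupp.single 2 c + Finsupp.single 3 d) =
      Finsupp.single 0 (a + b + d - p) + Finsupp.single 1 b + Finsupp.single 2 c + Finsupp.single 3 d := by
  ext i; fin_cases i <;>
    simp [CentreBlowup.chartExponent, Finsupp.update_apply, degIn_triple (show (0 : Fin 4) ≠ 1 by decide)
      (show (0 : Fin 4) ≠ 3 by decide) (show (1 : Fin 4) ≠ 3 by decide)]

omit hp [CharP K p] in
/-- Chart `x₂` of the blow-up of `V(z, x₁, x₂, x₄)`. [cite: HauserPerlega2019PRIMS, §2 (the x₁-chart)] -/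
theorem chartExponent_V1_four (a b c d : ℕ) :
    CentreBlowup.chartExponent p ({0, 1, 3} : Finset (Fin 4)) 1
        (Finsupp.single 0 a + Finsupp.single 1 b + Finsupp.single 2 c + Finsupp.single 3 d) =
      Finsupp.single 0 a + Finsupp.single 1 (a + b + d - p) + Finsupp.single 2 c + Finsupp.single 3 d := by
  ext i; fin_cases i <;>
    simp [CentreBlowup.chartExponent, Finsupp.update_apply, degIn_triple (show (0 : Fin 4) ≠ 1 by decide)
      (show (0 : Fin 4) ≠ 3 by decide) (show (1 : Fin 4) ≠ 3 by decide)]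

omit hp [CharP K p] in
/-- Chart `x₄` of the blow-up of `V(z, x₁, x₂, x₄)`. [cite: HauserPerlega2019PRIMS, §2 (the x₁-chart)] -/
theorem chartExponent_V3_four (a b c d : ℕ) :
    CentreBlowup.chartExponent p ({0, 1, 3} : Finset (Fin 4)) 3
        (Finsupp.single 0 a + Finsupp.single 1 b + Finsupp.single 2 c + Finsupp.single 3 d) =
      Finsupp.single 0 a + Finsupp.single 1 b + Finsupp.single 2 c + Finsupp.single 3 (a + b + d - p) := by
  ext i; fin_cases i <;>
    simp [CentreBlowup.chartExponent, Finsupp.update_apply, degIn_triple (show (0 : Fin 4) ≠ 1 by decide)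
      (show (0 : Fin 4) ≠ 3 by decide) (show (1 : Fin 4) ≠ 3 by decide)]

omit [CharP K p] in
/-- **Root chart `x₁`**: `F ↦ F₁ = y₂^{p−1} y₃ y₄ + y₁^{p−1} y₂ + y₁ y₂^{p+1}`. [cite: HauserPerlega2019PRIMS, §2 (the x₁-chart)] -/
theorem chartTransform_S0_hcert :
    CentreBlowup.chartTransform p ({0, 1} : Finset (Fin 4)) 0
        (X 0 * X 1 ^ (p - 1) * X 2 * X 3 + X 0 ^ (2 * p - 2) * X 1 + X 1 ^ (p + 1) : MvPolynomial (Fin 4) K) =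
      C 1 * (X 0 ^ 0 * X 1 ^ (p - 1) * X 2 ^ 1 * X 3 ^ 1) + C 1 * (X 0 ^ (p - 1) * X 1 ^ 1 * X 2 ^ 0 * X 3 ^ 0) +
        C 1 * (X 0 ^ 1 * X 1 ^ (p + 1) * X 2 ^ 0 * X 3 ^ 0) := by
  have hp1 : 1 ≤ p := hp.out.one_lt.le
  rw [hcert_eq]
  simp only [C_mul_X_pow_four, CentreBlowup.chartTransform_add, CentreBlowup.chartTransform_monomial, chartExponent_S0_four]
  rw [show 1 + (p - 1) - p = 0 by omega, show 2 * p - 2 + 1 - p = p - 1 by omega, show 0 + (p + 1) - p = 1 by omega]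

omit [CharP K p] in
/-- **Root chart `x₂`**: `F ↦ F₂ = y₁ y₃ y₄ + y₁^{2p−2} y₂^{p−1} + y₂`. [cite: HauserPerlega2019PRIMS, §2 (the x₁-chart)] -/
theorem chartTransform_S1_hcert :
    CentreBlowup.chartTransform p ({0, 1} : Finset (Fin 4)) 1
        (X 0 * X 1 ^ (p - 1) * X 2 * X 3 + X 0 ^ (2 * p - 2) * X 1 + X 1 ^ (p + 1) : MvPolynomial (Fin 4) K) =
      C 1 * (X 0 ^ 1 * X 1 ^ 0 * X 2 ^ 1 * X 3 ^ 1) + C 1 * (X 0 ^ (2 * p - 2) * X 1 ^ (p - 1) * X 2 ^ 0 * X 3 ^ 0) +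
        C 1 * (X 0 ^ 0 * X 1 ^ 1 * X 2 ^ 0 * X 3 ^ 0) := by
  have hp1 : 1 ≤ p := hp.out.one_lt.le
  rw [hcert_eq]
  simp only [C_mul_X_pow_four, CentreBlowup.chartTransform_add, CentreBlowup.chartTransform_monomial, chartExponent_S1_four]
  rw [show 1 + (p - 1) - p = 0 by omega, show 2 * p - 2 + 1 - p = p - 1 by omega, show 0 + (p + 1) - p = 1 by omega]

omit [CharP K p] in
/-- **Child chart `y₁`** of `F₁` along `V(z, y₁, y₂, y₃)`: `G₀ = u₂^{p−1} u₃ u₄ + u₂ + u₁² u₂^{p+1}`. -/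
theorem chartTransform_U0_hcert :
    CentreBlowup.chartTransform p ({0, 1, 2} : Finset (Fin 4)) 0
        (C 1 * (X 0 ^ 0 * X 1 ^ (p - 1) * X 2 ^ 1 * X 3 ^ 1) + C 1 * (X 0 ^ (p - 1) * X 1 ^ 1 * X 2 ^ 0 * X 3 ^ 0) +
          C 1 * (X 0 ^ 1 * X 1 ^ (p + 1) * X 2 ^ 0 * X 3 ^ 0) : MvPolynomial (Fin 4) K) =
      C 1 * (X 0 ^ 0 * X 1 ^ (p - 1) * X 2 ^ 1 * X 3 ^ 1) + C 1 * (X 0 ^ 0 * X 1 ^ 1 * X 2 ^ 0 * X 3 ^ 0) +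
        C 1 * (X 0 ^ 2 * X 1 ^ (p + 1) * X 2 ^ 0 * X 3 ^ 0) := by
  have hp1 : 1 ≤ p := hp.out.one_lt.le
  simp only [C_mul_X_pow_four, CentreBlowup.chartTransform_add, CentreBlowup.chartTransform_monomial, chartExponent_U0_four]
  rw [show 0 + (p - 1) + 1 - p = 0 by omega, show p - 1 + 1 + 0 - p = 0 by omega, show 1 + (p + 1) + 0 - p = 2 by omega]

omit [CharP K p] in
/-- **Child chart `y₂`**: `G₁ = v₃ v₄ + v₁^{p−1} + v₁ v₂²`. -/
theorem chartTransform_U1_hcert :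
    CentreBlowup.chartTransform p ({0, 1, 2} : Finset (Fin 4)) 1
        (C 1 * (X 0 ^ 0 * X 1 ^ (p - 1) * X 2 ^ 1 * X 3 ^ 1) + C 1 * (X 0 ^ (p - 1) * X 1 ^ 1 * X 2 ^ 0 * X 3 ^ 0) +
          C 1 * (X 0 ^ 1 * X 1 ^ (p + 1) * X 2 ^ 0 * X 3 ^ 0) : MvPolynomial (Fin 4) K) =
      C 1 * (X 0 ^ 0 * X 1 ^ 0 * X 2 ^ 1 * X 3 ^ 1) + C 1 * (X 0 ^ (p - 1) * X 1 ^ 0 * X 2 ^ 0 * X 3 ^ 0) +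
        C 1 * (X 0 ^ 1 * X 1 ^ 2 * X 2 ^ 0 * X 3 ^ 0) := by
  have hp1 : 1 ≤ p := hp.out.one_lt.le
  simp only [C_mul_X_pow_four, CentreBlowup.chartTransform_add, CentreBlowup.chartTransform_monomial, chartExponent_U1_four]
  rw [show 0 + (p - 1) + 1 - p = 0 by omega, show p - 1 + 1 + 0 - p = 0 by omega, show 1 + (p + 1) + 0 - p = 2 by omega]

omit [CharP K p] in
/-- **Child chart `y₃`**: `G₂ = w₂^{p−1} w₄ + w₁^{p−1} w₂ + w₁ w₂^{p+1} w₃²`. -/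
theorem chartTransform_U2_hcert :
    CentreBlowup.chartTransform p ({0, 1, 2} : Finset (Fin 4)) 2
        (C 1 * (X 0 ^ 0 * X 1 ^ (p - 1) * X 2 ^ 1 * X 3 ^ 1) + C 1 * (X 0 ^ (p - 1) * X 1 ^ 1 * X 2 ^ 0 * X 3 ^ 0) +
          C 1 * (X 0 ^ 1 * X 1 ^ (p + 1) * X 2 ^ 0 * X 3 ^ 0) : MvPolynomial (Fin 4) K) =
      C 1 * (X 0 ^ 0 * X 1 ^ (p - 1) * X 2 ^ 0 * X 3 ^ 1) + C 1 * (X 0 ^ (p - 1) * X 1 ^ 1 * X 2 ^ 0 * X 3 ^ 0) +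
        C 1 * (X 0 ^ 1 * X 1 ^ (p + 1) * X 2 ^ 2 * X 3 ^ 0) := by
  have hp1 : 1 ≤ p := hp.out.one_lt.le
  simp only [C_mul_X_pow_four, CentreBlowup.chartTransform_add, CentreBlowup.chartTransform_monomial, chartExponent_U2_four]
  rw [show 0 + (p - 1) + 1 - p = 0 by omega, show p - 1 + 1 + 0 - p = 0 by omega, show 1 + (p + 1) + 0 - p = 2 by omega]

omit [CharP K p] in
/-- **Kid chart `w₁`** of `G₂` along `V(z, w₁, w₂, w₄)`: `H₀ = t₂^{p−1} t₄ + t₂ + t₁² t₂^{p+1} t₃²`. -/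
theorem chartTransform_V0_hcert :
    CentreBlowup.chartTransform p ({0, 1, 3} : Finset (Fin 4)) 0
        (C 1 * (X 0 ^ 0 * X 1 ^ (p - 1) * X 2 ^ 0 * X 3 ^ 1) + C 1 * (X 0 ^ (p - 1) * X 1 ^ 1 * X 2 ^ 0 * X 3 ^ 0) +
          C 1 * (X 0 ^ 1 * X 1 ^ (p + 1) * X 2 ^ 2 * X 3 ^ 0) : MvPolynomial (Fin 4) K) =
      C 1 * (X 0 ^ 0 * X 1 ^ (p - 1) * X 2 ^ 0 * X 3 ^ 1) + C 1 * (X 0 ^ 0 * X 1 ^ 1 * X 2 ^ 0 * X 3 ^ 0) +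
        C 1 * (X 0 ^ 2 * X 1 ^ (p + 1) * X 2 ^ 2 * X 3 ^ 0) := by
  have hp1 : 1 ≤ p := hp.out.one_lt.le
  simp only [C_mul_X_pow_four, CentreBlowup.chartTransform_add, CentreBlowup.chartTransform_monomial, chartExponent_V0_four]
  rw [show 0 + (p - 1) + 1 - p = 0 by omega, show p - 1 + 1 + 0 - p = 0 by omega, show 1 + (p + 1) + 0 - p = 2 by omega]

omit [CharP K p] in
/-- **Kid chart `w₂`**: `H₁ = t₄ + t₁^{p−1} + t₁ t₂² t₃²`. -/
theorem chartTransform_V1_hcert :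
    CentreBlowup.chartTransform p ({0, 1, 3} : Finset (Fin 4)) 1
        (C 1 * (X 0 ^ 0 * X 1 ^ (p - 1) * X 2 ^ 0 * X 3 ^ 1) + C 1 * (X 0 ^ (p - 1) * X 1 ^ 1 * X 2 ^ 0 * X 3 ^ 0) +
          C 1 * (X 0 ^ 1 * X 1 ^ (p + 1) * X 2 ^ 2 * X 3 ^ 0) : MvPolynomial (Fin 4) K) =
      C 1 * (X 0 ^ 0 * X 1 ^ 0 * X 2 ^ 0 * X 3 ^ 1) + C 1 * (X 0 ^ (p - 1) * X 1 ^ 0 * X 2 ^ 0 * X 3 ^ 0) +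
        C 1 * (X 0 ^ 1 * X 1 ^ 2 * X 2 ^ 2 * X 3 ^ 0) := by
  have hp1 : 1 ≤ p := hp.out.one_lt.le
  simp only [C_mul_X_pow_four, CentreBlowup.chartTransform_add, CentreBlowup.chartTransform_monomial, chartExponent_V1_four]
  rw [show 0 + (p - 1) + 1 - p = 0 by omega, show p - 1 + 1 + 0 - p = 0 by omega, show 1 + (p + 1) + 0 - p = 2 by omega]

omit [CharP K p] in
/-- **Kid chart `w₄`**: `H₃ = t₂^{p−1} + t₁^{p−1} t₂ + t₁ t₂^{p+1} t₃² t₄²`. -/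
theorem chartTransform_V3_hcert :
    CentreBlowup.chartTransform p ({0, 1, 3} : Finset (Fin 4)) 3
        (C 1 * (X 0 ^ 0 * X 1 ^ (p - 1) * X 2 ^ 0 * X 3 ^ 1) + C 1 * (X 0 ^ (p - 1) * X 1 ^ 1 * X 2 ^ 0 * X 3 ^ 0) +
          C 1 * (X 0 ^ 1 * X 1 ^ (p + 1) * X 2 ^ 2 * X 3 ^ 0) : MvPolynomial (Fin 4) K) =
      C 1 * (X 0 ^ 0 * X 1 ^ (p - 1) * X 2 ^ 0 * X 3 ^ 0) + C 1 * (X 0 ^ (p - 1) * X 1 ^ 1 * X 2 ^ 0 * X 3 ^ 0) +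
        C 1 * (X 0 ^ 1 * X 1 ^ (p + 1) * X 2 ^ 2 * X 3 ^ 2) := by
  have hp1 : 1 ≤ p := hp.out.one_lt.le
  simp only [C_mul_X_pow_four, CentreBlowup.chartTransform_add, CentreBlowup.chartTransform_monomial, chartExponent_V3_four]
  rw [show 0 + (p - 1) + 1 - p = 0 by omega, show p - 1 + 1 + 0 - p = 0 by omega, show 1 + (p + 1) + 0 - p = 2 by omega]

/-! ## §2 Supports, cleanness, permissibility -/

omit hp [CharP K p] in
/-- Support of a sum of three four-exponent monomials. [folklore] -/
theorem mem_support_three {e : Fin 4 →₀ ℕ} {r₁ r₂ r₃ : K} {a₁ b₁ c₁ d₁ a₂ b₂ c₂ d₂ a₃ b₃ c₃ d₃ : ℕ}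
    (he : e ∈ (C r₁ * (X 0 ^ a₁ * X 1 ^ b₁ * X 2 ^ c₁ * X 3 ^ d₁) + C r₂ * (X 0 ^ a₂ * X 1 ^ b₂ * X 2 ^ c₂ * X 3 ^ d₂) +
        C r₃ * (X 0 ^ a₃ * X 1 ^ b₃ * X 2 ^ c₃ * X 3 ^ d₃) : MvPolynomial (Fin 4) K).support) :
    e = Finsupp.single 0 a₁ + Finsupp.single 1 b₁ + Finsupp.single 2 c₁ + Finsupp.single 3 d₁ ∨
      e = Finsupp.single 0 a₂ + Finsupp.single 1 b₂ + Finsupp.single 2 c₂ + Finsupp.single 3 d₂ ∨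
      e = Finsupp.single 0 a₃ + Finsupp.single 1 b₃ + Finsupp.single 2 c₃ + Finsupp.single 3 d₃ := by
  rw [C_mul_X_pow_four, C_mul_X_pow_four, C_mul_X_pow_four] at he
  rcases Finset.mem_union.mp (Finset.mem_of_subset MvPolynomial.support_add he) with h | h
  · rcases Finset.mem_union.mp (Finset.mem_of_subset MvPolynomial.support_add h) with h | h
    · exact Or.inl (Finset.mem_singleton.mp (Finset.mem_of_subset support_monomial_subset h))
    · exact Or.inr (Or.inl (Finset.mem_singleton.mp (Finset.mem_of_subset support_monomial_subset h)))
  · exact Or.inr (Or.inr (Finset.mem_singleton.mp (Finset.mem_of_subset support_monomial_subset h)))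

omit hp [CharP K p] in
/-- **`F` is clean** (`p ≥ 3`: exponents `1` of `x₁`, `1` of `x₂`, `p + 1` of `x₂`). [cite: HauserPerlega2019PRIMS, §2 (cleaning)] -/
theorem isClean_hcert (hp3 : 3 ≤ p) :
    Literature.Barriers.ResolutionOfSingularities.HauserPerlega.IsClean p
      (X 0 * X 1 ^ (p - 1) * X 2 * X 3 + X 0 ^ (2 * p - 2) * X 1 + X 1 ^ (p + 1) : MvPolynomial (Fin 4) K) := by
  intro d hd hpth
  rw [hcert_eq] at hd
  have key1 : ∀ i : Fin 4, d i = 1 → False := fun i hi => by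
    have h := hpth i (by rw [Finsupp.mem_support_iff, hi]; exact one_ne_zero)
    rw [hi] at h
    exact (show (1 : ℕ) < p by omega).ne' (Nat.dvd_one.mp h)
  have key2 : ∀ i : Fin 4, d i = p + 1 → False := fun i hi => by
    have h := hpth i (by rw [Finsupp.mem_support_iff, hi]; omega)
    rw [hi] at h
    have := (Nat.dvd_add_right (dvd_refl p)).mp h
    exact (show (1 : ℕ) < p by omega).ne' (Nat.dvd_one.mp this)
  rcases mem_support_three hd with rfl | rfl | rfl
  · exact key1 0 (by simp)
  · exact key1 1 (by simp)
  · exact key2 1 (by simp)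

omit hp [CharP K p] in
/-- **`F₁` is clean** (exponents `1` of `y₃`, `1` of `y₂`, `p + 1` of `y₂`). [cite: HauserPerlega2019PRIMS, §2 (cleaning)] -/
theorem isClean_F1_hcert (hp3 : 3 ≤ p) :
    Literature.Barriers.ResolutionOfSingularities.HauserPerlega.IsClean p
      (C 1 * (X 0 ^ 0 * X 1 ^ (p - 1) * X 2 ^ 1 * X 3 ^ 1) + C 1 * (X 0 ^ (p - 1) * X 1 ^ 1 * X 2 ^ 0 * X 3 ^ 0) +
        C 1 * (X 0 ^ 1 * X 1 ^ (p + 1) * X 2 ^ 0 * X 3 ^ 0) : MvPolynomial (Fin 4) K) := by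
  intro d hd hpth
  have key1 : ∀ i : Fin 4, d i = 1 → False := fun i hi => by
    have h := hpth i (by rw [Finsupp.mem_support_iff, hi]; exact one_ne_zero)
    rw [hi] at h
    exact (show (1 : ℕ) < p by omega).ne' (Nat.dvd_one.mp h)
  rcases mem_support_three hd with rfl | rfl | rfl
  · exact key1 2 (by simp)
  · exact key1 1 (by simp)
  · exact key1 0 (by simp)

omit hp [CharP K p] in
/-- **`G₂` is clean** (exponents `1` of `w₄`, `1` of `w₂`, `1` of `w₁`). [cite: HauserPerlega2019PRIMS, §2 (cleaning)] -/
theorem isClean_G2_hcert (hp3 : 3 ≤ p) :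
    Literature.Barriers.ResolutionOfSingularities.HauserPerlega.IsClean p
      (C 1 * (X 0 ^ 0 * X 1 ^ (p - 1) * X 2 ^ 0 * X 3 ^ 1) + C 1 * (X 0 ^ (p - 1) * X 1 ^ 1 * X 2 ^ 0 * X 3 ^ 0) +
        C 1 * (X 0 ^ 1 * X 1 ^ (p + 1) * X 2 ^ 2 * X 3 ^ 0) : MvPolynomial (Fin 4) K) := by
  intro d hd hpth
  have key1 : ∀ i : Fin 4, d i = 1 → False := fun i hi => by
    have h := hpth i (by rw [Finsupp.mem_support_iff, hi]; exact one_ne_zero)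
    rw [hi] at h
    exact (show (1 : ℕ) < p by omega).ne' (Nat.dvd_one.mp h)
  rcases mem_support_three hd with rfl | rfl | rfl
  · exact key1 3 (by simp)
  · exact key1 1 (by simp)
  · exact key1 0 (by simp)

omit hp [CharP K p] in
/-- `F ≠ 0` (the coefficient of `x₂^{p+1}` is `1`). [folklore] -/
theorem hcert_ne_zero (hp3 : 3 ≤ p) :
    (X 0 * X 1 ^ (p - 1) * X 2 * X 3 + X 0 ^ (2 * p - 2) * X 1 + X 1 ^ (p + 1) : MvPolynomial (Fin 4) K) ≠ 0 := by
  intro h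
  have hc := congrArg (coeff (Finsupp.single (0 : Fin 4) 0 + Finsupp.single 1 (p + 1) + Finsupp.single 2 0 +
    Finsupp.single 3 0)) h
  rw [hcert_eq, C_mul_X_pow_four, C_mul_X_pow_four, C_mul_X_pow_four, coeff_add, coeff_add, coeff_monomial, coeff_monomial,
    coeff_monomial, if_neg, if_neg, if_pos rfl, coeff_zero] at hc
  · simp at hc
  · intro h'; have := DFunLike.congr_fun h' 0; simp at this; omega
  · intro h'; have := DFunLike.congr_fun h' 0; simp at this

omit hp [CharP K p] in
/-- **`V(z, x₁, x₂)` is permissible for `z^p + F`** (the root host). [cite: HauserPerlega2019PRIMS, §2 (condition (1))] -/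
theorem isPermissibleCentre_S_hcert (hp1 : 1 ≤ p) :
    IsPermissibleCentre p ({0, 1} : Finset (Fin 4))
      (X 0 * X 1 ^ (p - 1) * X 2 * X 3 + X 0 ^ (2 * p - 2) * X 1 + X 1 ^ (p + 1) : MvPolynomial (Fin 4) K) := by
  refine ⟨⟨0, by simp⟩, Finset.le_inf fun d hd => ?_⟩
  rw [hcert_eq] at hd
  rcases mem_support_three hd with rfl | rfl | rfl <;>
    simp [CentreBlowup.degIn_pair (show (0 : Fin 4) ≠ 1 by decide)] <;> norm_cast <;> omega

omit hp [CharP K p] in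
/-- **`V(z, y₁, y₂, y₃)` is permissible for `z^p + F₁`** (the child). [cite: HauserPerlega2019PRIMS, §2 (condition (1))] -/
theorem isPermissibleCentre_U_F1_hcert (hp1 : 1 ≤ p) :
    IsPermissibleCentre p ({0, 1, 2} : Finset (Fin 4))
      (C 1 * (X 0 ^ 0 * X 1 ^ (p - 1) * X 2 ^ 1 * X 3 ^ 1) + C 1 * (X 0 ^ (p - 1) * X 1 ^ 1 * X 2 ^ 0 * X 3 ^ 0) +
        C 1 * (X 0 ^ 1 * X 1 ^ (p + 1) * X 2 ^ 0 * X 3 ^ 0) : MvPolynomial (Fin 4) K) := by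
  refine ⟨⟨0, by simp⟩, Finset.le_inf fun d hd => ?_⟩
  rcases mem_support_three hd with rfl | rfl | rfl <;>
    simp [degIn_triple (show (0 : Fin 4) ≠ 1 by decide) (show (0 : Fin 4) ≠ 2 by decide) (show (1 : Fin 4) ≠ 2 by decide)] <;>
    norm_cast <;> omega

omit hp [CharP K p] in
/-- **`V(z, y₁, y₂, y₄)` is permissible for `z^p + F₁`** (the hereditary waiting sibling of the child).
[cite: HauserPerlega2019PRIMS, §2 (condition (1))] -/
theorem isPermissibleCentre_V_F1_hcert (hp1 : 1 ≤ p) :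
    IsPermissibleCentre p ({0, 1, 3} : Finset (Fin 4))
      (C 1 * (X 0 ^ 0 * X 1 ^ (p - 1) * X 2 ^ 1 * X 3 ^ 1) + C 1 * (X 0 ^ (p - 1) * X 1 ^ 1 * X 2 ^ 0 * X 3 ^ 0) +
        C 1 * (X 0 ^ 1 * X 1 ^ (p + 1) * X 2 ^ 0 * X 3 ^ 0) : MvPolynomial (Fin 4) K) := by
  refine ⟨⟨0, by simp⟩, Finset.le_inf fun d hd => ?_⟩
  rcases mem_support_three hd with rfl | rfl | rfl <;>
    simp [degIn_triple (show (0 : Fin 4) ≠ 1 by decide) (show (0 : Fin 4) ≠ 3 by decide) (show (1 : Fin 4) ≠ 3 by decide)] <;>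
    norm_cast <;> omega

omit hp [CharP K p] in
/-- **`V(z, w₁, w₂, w₄)` is permissible for `z^p + G₂`** (the waiting kid). [cite: HauserPerlega2019PRIMS, §2 (condition (1))] -/
theorem isPermissibleCentre_V_G2_hcert (hp1 : 1 ≤ p) :
    IsPermissibleCentre p ({0, 1, 3} : Finset (Fin 4))
      (C 1 * (X 0 ^ 0 * X 1 ^ (p - 1) * X 2 ^ 0 * X 3 ^ 1) + C 1 * (X 0 ^ (p - 1) * X 1 ^ 1 * X 2 ^ 0 * X 3 ^ 0) +
        C 1 * (X 0 ^ 1 * X 1 ^ (p + 1) * X 2 ^ 2 * X 3 ^ 0) : MvPolynomial (Fin 4) K) := by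
  refine ⟨⟨0, by simp⟩, Finset.le_inf fun d hd => ?_⟩
  rcases mem_support_three hd with rfl | rfl | rfl <;>
    simp [degIn_triple (show (0 : Fin 4) ≠ 1 by decide) (show (0 : Fin 4) ≠ 3 by decide) (show (1 : Fin 4) ≠ 3 by decide)] <;>
    norm_cast <;> omega

/-! ## §3 The root parameters -/

/-- **The root locus is the host**: if every non-constant monomial of degree `< p` of `F(x + b)` vanishes then `b₁ = b₂ = 0`
(first derivatives: `∂₃F = x₁x₂^{p−1}x₄`, `∂₄F = x₁x₂^{p−1}x₃`, `∂₂F = −x₁x₂^{p−2}x₃x₄ + x₁^{2p−2} + x₂^p`,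
`∂₁F = x₂^{p−1}x₃x₄ − 2x₁^{2p−3}x₂`; `p ≥ 3`). [cite: Hauser2010, §F (equiconstant points)] -/
theorem roots_hcert (hp3 : 3 ≤ p) (b : Fin 4 → K)
    (H : ∀ d : Fin 4 →₀ ℕ, d ≠ 0 → d.degree < p → coeff d (PointBlowup.translate b
      (X 0 * X 1 ^ (p - 1) * X 2 * X 3 + X 0 ^ (2 * p - 2) * X 1 + X 1 ^ (p + 1) : MvPolynomial (Fin 4) K)) = 0) :
    b 0 = 0 ∧ b 1 = 0 := by
  have hp0 : p ≠ 0 := hp.out.ne_zero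
  have hpK : (p : K) = 0 := CharP.cast_eq_zero K p
  have h0 := eval_pderiv_eq_zero_of_forall_coeff b _ H 0
  have h1 := eval_pderiv_eq_zero_of_forall_coeff b _ H 1
  have h2 := eval_pderiv_eq_zero_of_forall_coeff b _ H 2
  have h3 := eval_pderiv_eq_zero_of_forall_coeff b _ H 3
  simp [(pderiv (0 : Fin 4)).leibniz_pow, (pderiv (1 : Fin 4)).leibniz_pow, (pderiv (2 : Fin 4)).leibniz_pow,
    (pderiv (3 : Fin 4)).leibniz_pow] at h0 h1 h2 h3
  have h22 : ((2 * p - 2 : ℕ) : K) ≠ 0 := by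
    rw [Ne, CharP.cast_eq_zero_iff K p]
    intro hdvd
    have h2 : p ∣ 2 := (Nat.dvd_sub_iff_right (by omega) (dvd_mul_left p 2)).mp hdvd
    exact absurd (Nat.le_of_dvd two_pos h2) (by omega)
  have hb0 : b 0 = 0 := by
    by_contra hb0
    by_cases hb1 : b 1 = 0
    · rw [hb1, zero_pow (by omega), mul_zero, mul_zero, mul_zero, mul_zero, zero_add, zero_pow hp0, add_zero] at h1
      exact hb0 (pow_eq_zero_iff (by omega) |>.mp h1)
    · have hb3 : b 3 = 0 := by
        rcases h2 with h | h | ⟨h, -⟩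
        · exact h
        · exact absurd h hb0
        · exact absurd h hb1
      have hb2 : b 2 = 0 := by
        rcases h3 with (h | ⟨h, -⟩) | h
        · exact absurd h hb0
        · exact absurd h hb1
        · exact h
      rw [hb3, zero_mul, zero_add] at h0
      rcases mul_eq_zero.mp h0 with h | h
      · exact hb1 h
      · rcases mul_eq_zero.mp h with h | h
        · exact h22 h
        · exact hb0 (pow_eq_zero_iff (by omega) |>.mp h)
  refine ⟨hb0, ?_⟩
  rw [hb0, zero_pow (by omega), zero_mul, mul_zero, mul_zero, zero_add, zero_add] at h1
  exact pow_eq_zero_iff hp0 |>.mp h1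

end HCertComputations

end Equimultiple

end Summit.ResolutionOfSingularities.ResolutionOfSingularities.Theorems.PIDim4

end
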